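import Summits.HodgeConjecture.HodgeConjecture.Theorems.Ring2AbelianAllAndreFibreClassCodim
import Summits.HodgeConjecture.HodgeConjecture.Theorems.Ring2AbelianAllAndreWeilPencilsCMPower
import HarnessLib

/-!
# Ring 2 · sub-cell AbelianAll (ALL ABELIAN VARIETIES), André axis, part X-e — the Weil rows of part IX with
# their Lefschetz input priced by codimension-`2n` Hodge classes on the squares of the total spaces
# (for `W₆`: codimension-6 rational Hodge classes on the 14-folds `𝒳 × 𝒳` of the `E`-power-pointed compact
# Weil-sixfold pencils), modulo the print-true topological supply nodes (κ), (φ); NO `HC_CM`, NO named fact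

HONEST FRAMING (page 1, verbatim): **research route, not a corollary; conditional on HC_CM plus one named
minimal statement.** Cell line: research route conditional on HC_CM; not a corollary; Q11.4-sentence-2
already refuted in dim ≥ 3. Nothing in this file proves a case of the Hodge conjecture; `WeilSixfolds`
(stmt-HodgeConjecture-2524), `NonsplitSixfolds`, `WeilClassesImaginaryQuadratic` (R∞) stay OPEN — every theorem
below has OPEN typed nodes among its hypotheses ((W_E)ₙ, κ, φ, and the codimension-`2n` case of the Hodge
conjecture for the squares of the total spaces). Seat `pub-hodge-ring2-ab-andre-2`, gen 3 (owed o10 of RING2-MAP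
§AbelianAll AA2.22, by-name rows for the Weil column / hweil's companions).

Content: part IX's `HC_CM`-free Weil rows `(W_E)ₙ ∧ (β′)_{2n} ⟹ R∞ / WeilSixfolds / NonsplitSixfolds` composed with
part X-d's `fibreClassLefschetzOnAtRelDim_of_codim` ((β′)_d ⟸[κ, φ] "rational `(d,d)`-classes on `𝒳 × 𝒳` are
algebraic for every compact abelian pencil `𝒳 → C` of relative dimension `d`"). So the smallest open instance
of the André/Lefschetz column reads, with every input named: **`(W_E)₃ ∧ κ ∧ φ ∧ HC^{6}(𝒳 × 𝒳 for rel-dim-6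
CM-pointed compact abelian pencils) ⟹ WeilSixfolds`**, where κ, φ are print-true topology (Deligne; Fulton) and
the only cycle-theoretic input is ONE codimension of the Hodge conjecture on 14-folds.

References: Abdulali1994FamiliesAV (Conj. 5.3, Rem. 5.4); Andre1996Motifs (Remarque 2); Weil1977HodgeRing;
vanGeemen1994HodgeAV (5.3–5.8); Voisin2025 (Prop. 2.11, §3.2.2); DeligneHodgeII1971 (4.1.1, 4.2.6); Fulton1998
(Prop. 19.1.1).
-/

noncomputable section

set_option linter.dupNamespace false

namespace Summit.HodgeConjecture.HodgeConjecture.Ring2.AbelianAll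

open CategoryTheory AlgebraicGeometry MonoidalCategory
open Literature.AlgebraicGeometry Literature.AlgebraicGeometry.Motives
open Literature.AlgebraicGeometry.HodgeTheory
open Literature.AlgebraicGeometry.Deligne1982 (cmLocus)
open Summit.HodgeConjecture.HodgeConjecture
open Summit.HodgeConjecture.HodgeConjecture.Theses
open Summit.HodgeConjecture.HodgeConjecture.WeilTypeLadder (WeilClassesImaginaryQuadratic NonsplitSixfolds)

/-- **THE SMALLEST OPEN INSTANCE with every input named: `(W_E)₃ ∧ κ ∧ φ ∧ HC^{6}(squares of rel-dim-6 pencils)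
⟹ WeilSixfolds`** (stmt-HodgeConjecture-2524; NO `HC_CM`, NO named fact): Weil classes on every Weil-type abelian
sixfold are algebraic if (W_E)₃ every such sixfold sits in a compact Weil pencil `𝒳⁷ → C` with an `E`-power fibre,
(κ) Deligne's kernel identity and (φ) fibre-class constancy hold on compact abelian pencils (print-true topology),
and the rational `(6,6)`-classes of the 14-fold `𝒳 × 𝒳` are algebraic for every compact abelian pencil of relative
dimension `6`. research route, not a corollary; conditional on HC_CM plus one named minimal statement.
[cite: Abdulali1994FamiliesAV, Conjecture 5.3 and Remark 5.4 (p. 1130)] [cite: Andre1996Motifs, §6.3 Remarque 2 (p. 33)]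
[cite: Weil1977HodgeRing] -/
theorem weilSixfolds_of_cmPowerWeilPencilsAt_of_kernel_of_codimSix (hW : CMPowerAnchoredCompactWeilPencilsAt 3)
    (hκ : FibreGysinKernelCompactPencils) (hφ : FibreClassConstantCompactPencils)
    (halg : ∀ ⦃𝒳 S : SchemeOver ℂ⦄ ⦃f : 𝒳 ⟶ S⦄, IsCompactAbelianPencil f 6 →
      ∀ c : complexBetti (𝒳 ⊗ 𝒳) (2 * 6), IsRationalClass c →
        IsOfHodgeType ((6 + 1) + (6 + 1)) (𝒳 ⊗ 𝒳) (2 * 6) 6 6 c → c ∈ algebraicClasses (𝒳 ⊗ 𝒳) 6) :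
    Theses.SevenfoldWeilCensus.WeilSixfolds :=
  weilSixfolds_of_cmPowerWeilPencilsAt_of_fibreClassLefschetzOnAtRelDim_six hW
    (fibreClassLefschetzOnAtRelDim_of_codim 6 hκ hφ halg)

/-- The same for the NON-SPLIT sixfolds (hweil's rung R1′, outside Markman/Schoen and outside Lemme 6.3.3's split
habitat). [cite: Andre1996Motifs, §6.3 Remarque 2 (p. 33)] -/
theorem nonsplitSixfolds_of_cmPowerWeilPencilsAt_of_kernel_of_codimSix (hW : CMPowerAnchoredCompactWeilPencilsAt 3)
    (hκ : FibreGysinKernelCompactPencils) (hφ : FibreClassConstantCompactPencils)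
    (halg : ∀ ⦃𝒳 S : SchemeOver ℂ⦄ ⦃f : 𝒳 ⟶ S⦄, IsCompactAbelianPencil f 6 →
      ∀ c : complexBetti (𝒳 ⊗ 𝒳) (2 * 6), IsRationalClass c →
        IsOfHodgeType ((6 + 1) + (6 + 1)) (𝒳 ⊗ 𝒳) (2 * 6) 6 6 c → c ∈ algebraicClasses (𝒳 ⊗ 𝒳) 6) :
    NonsplitSixfolds :=
  nonsplitSixfolds_of_cmPowerWeilPencilsAt_of_fibreClassLefschetzOnAtRelDim_six hW
    (fibreClassLefschetzOnAtRelDim_of_codim 6 hκ hφ halg)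

/-- **Weil's question (R∞) for all `n ≥ 2`**: `(∀ n ≥ 2, (W_E)ₙ) ∧ κ ∧ φ ∧ (∀ n ≥ 2, HC^{2n} of the squares of the
rel-dim-`2n` compact abelian pencils) ⟹ WeilClassesImaginaryQuadratic` — NO `HC_CM`, NO named fact.
[cite: Weil1977HodgeRing] [cite: Abdulali1994FamiliesAV, Conjecture 5.3 (p. 1130)] -/
theorem weilClassesImaginaryQuadratic_of_cmPowerWeilPencils_of_kernel_of_codim
    (hW : ∀ n, 2 ≤ n → CMPowerAnchoredCompactWeilPencilsAt n)
    (hκ : FibreGysinKernelCompactPencils) (hφ : FibreClassConstantCompactPencils)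
    (halg : ∀ n, 2 ≤ n → ∀ ⦃𝒳 S : SchemeOver ℂ⦄ ⦃f : 𝒳 ⟶ S⦄, IsCompactAbelianPencil f (2 * n) →
      ∀ c : complexBetti (𝒳 ⊗ 𝒳) (2 * (2 * n)), IsRationalClass c →
        IsOfHodgeType ((2 * n + 1) + (2 * n + 1)) (𝒳 ⊗ 𝒳) (2 * (2 * n)) (2 * n) (2 * n) c →
          c ∈ algebraicClasses (𝒳 ⊗ 𝒳) (2 * n)) :
    WeilClassesImaginaryQuadratic :=
  weilClassesImaginaryQuadratic_of_cmPowerWeilPencils_of_fibreClassLefschetzOn hW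
    fun n hn ↦ fibreClassLefschetzOnAtRelDim_of_codim (2 * n) hκ hφ (halg n hn)

end Summit.HodgeConjecture.HodgeConjecture.Ring2.AbelianAll

end
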